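import Mathlib
import Literature.Computability.AlgebraicComplexity.ApolarityAction
import Literature.RepresentationTheory.GeneralLinear.OrbitLatticeProbes
import HarnessLib

/-!
# The Fischer (Bombieri) pairing as the constant term of apolarity: adjointness and unitary invariance

Topic `Literature/Computability/AlgebraicComplexity`; companion to `Apolarity.lean` / `ApolarityAction.lean`
(`apolarAction D f = D ⌟ f`, constant-coefficient differential operators acting on polynomials) and
`ApolarityTopPairing.lean` (the top-degree pairing).  Everything here is elementary and proved.

* `coeff_zero_apolarAction` — the constant term of `P ⌟ f` is the **Fischer pairing**
  `[P, f] := Σ_d d! · P_d · f_d` (`d! = ∏ᵢ dᵢ!`), for ALL `P, f` (no homogeneity needed);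
* `coeff_zero_linSubst`, `coeff_zero_apolarAction_linSubst` — linear substitutions preserve constant terms,
  whence the **adjointness** `[P, Q · f] = [Qᵀ · P, f]` for EVERY square matrix `Q` (from the tree's
  `GL`-equivariance `P ⌟ (Q·f) = Q·((QᵀP) ⌟ f)`);
* `fischer_map_linSubst_of_gram` — for a ring endomorphism `φ` (complex conjugation in the application) and
  square matrices `D, A` with the Gram identity `Aᵀ Dᵀ φ(A) = Dᵀ`, the sesquilinear form
  `(F, G) ↦ [φ F, D · G]` is invariant under `F ↦ A · F`; with `D = 1`, `φ = conj`, `A` unitary this is the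
  classical **unitary invariance of the Bombieri inner product** `⟨F, G⟩ = Σ_d d! conj(F_d) G_d`
  (`bombieri_linSubst_of_unitary`);
* `coeff_zero_apolarAction_map_diagonal` — with a diagonal weight `D = diag(c)` the form is the explicit sum
  `Σ_μ μ! c^μ φ(F_μ) G_μ` (monomials are orthogonal), and `fischer_diagonal_scaled_ne_zero` — over `ℂ`, for
  positive real weights and two positively rescaled copies of one nonzero polynomial the form is a positive real
  number (definiteness).

These are the ingredients of the unitarian-trick proof that a POSITIVE diagonal rescaling of a `GL`-stable ideal
never contains more highest-weight vectors than the ideal (`Summits/…/ValuativeGCTValuativeFlipTwistPositivity.lean`,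
BLMW 2011 Problem 6.10 "≥"), written here in the apolarity vocabulary so that the border-apolarity toolkit can use
the same pairing.

## References
* B. Beauzamy, E. Bombieri, P. Enflo, H. L. Montgomery, *Products of polynomials in many variables*,
  J. Number Theory 36 (1990) 219–245, §1 (the norm `[P]₂`, its unitary invariance).
* A. Iarrobino, V. Kanev, *Power Sums, Gorenstein Algebras, and Determinantal Loci*, LNM 1721 (1999), §1.1.
* J. M. Landsberg, *Geometry and Complexity Theory* (2017), §10.1.2.
-/

namespace Literature.Computability.AlgebraicComplexity

open MvPolynomial
open scoped BigOperators Matrix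
open Literature.RepresentationTheory.GeneralLinear (map_linSubst linSubst_diagonal_monomial)

section Pairing

variable {ι : Type*} {k : Type*} [CommRing k]

/-- **The Fischer pairing is the constant term of apolarity**: `coeff 0 (P ⌟ f) = Σ_{d ∈ supp P} P_d f_d d!`
(`d! = ∏ᵢ dᵢ!`) for all polynomials `P, f`: in `P ⌟ f = Σ_{e,d} P_e f_d (d!/(d-e)!) x^{d-e}` only the terms
`e = d` are constant (`x^{d-e} = 1` forces `d ≤ e`, the descending factorials force `e ≤ d`).
[cite: IarrobinoKanev1999, §1.1] -/
theorem coeff_zero_apolarAction (P f : MvPolynomial ι k) :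
    coeff 0 (apolarAction P f) =
      ∑ d ∈ P.support, coeff d P * coeff d f * ∏ i ∈ d.support, ((d i).factorial : k) := by
  classical
  rw [apolarAction_def, coeff_sum]
  refine Finset.sum_congr rfl fun e _ => ?_
  rw [coeff_sum, Finset.sum_eq_single e]
  · rw [tsub_self, coeff_monomial, if_pos rfl]
    congr 1
    exact Finset.prod_congr rfl fun i _ => by rw [Nat.descFactorial_self]
  · intro d _ hde
    rw [coeff_monomial]
    split_ifs with h0
    · have hle : d ≤ e := tsub_eq_zero_iff_le.mp h0
      obtain ⟨i, hi⟩ : ∃ i, d i < e i := by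
        by_contra hcon
        push Not at hcon
        exact hde (le_antisymm hle fun i => hcon i)
      have hi' : i ∈ e.support := by
        rw [Finsupp.mem_support_iff]
        omega
      rw [Finset.prod_eq_zero hi' (by rw [Nat.descFactorial_eq_zero_iff_lt.mpr hi, Nat.cast_zero]),
        mul_zero]
    · rfl
  · intro he
    rw [notMem_support_iff.mp he, mul_zero, zero_mul, map_zero, coeff_zero]

variable [Fintype ι]

/-- Linear substitutions (`X i ↦ Σ_j Q j i X j`, no constant terms) preserve the constant coefficient.
[folklore] -/
theorem coeff_zero_linSubst (Q : Matrix ι ι k) (h : MvPolynomial ι k) :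
    coeff 0 (linSubst ι k Q h) = coeff 0 h := by
  induction h using MvPolynomial.induction_on with
  | C c => rw [linSubst_C]
  | add p q hp hq => rw [map_add, coeff_add, coeff_add, hp, hq]
  | mul_X p i _ =>
    rw [map_mul, ← constantCoeff_eq, constantCoeff.map_mul, constantCoeff.map_mul, constantCoeff_X,
      mul_zero, linSubst_X, map_sum, Finset.sum_eq_zero, mul_zero]
    intro j _
    rw [smul_eq_C_mul, constantCoeff.map_mul, constantCoeff_X, mul_zero]

/-- **Adjointness of the Fischer pairing**: `[P, Q · f] = [Qᵀ · P, f]` for every square matrix `Q`, i.e.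
the transpose substitution is the adjoint of `Q·` — from the `GL`-equivariance of apolarity
`P ⌟ (Q·f) = Q·((QᵀP) ⌟ f)` (`apolarAction_linSubst`) and `coeff_zero_linSubst`.
[cite: BeauzamyBombieriEnfloMontgomery1990, §1] -/
theorem coeff_zero_apolarAction_linSubst (Q : Matrix ι ι k) (P f : MvPolynomial ι k) :
    coeff 0 (apolarAction P (linSubst ι k Q f)) = coeff 0 (apolarAction (linSubst ι k Qᵀ P) f) := by
  rw [apolarAction_linSubst, coeff_zero_linSubst]

/-- **Invariance of the sesquilinear Fischer form from a Gram identity.**  For a ring endomorphism `φ` of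
the coefficients and square matrices `D, A` with `Aᵀ · Dᵀ · φ(A) = Dᵀ`, the form `(F, G) ↦ [φ F, D · G]` is
invariant under `F ↦ A · F`: `[φ (A·F), D·(A·G)] = [φ F, D·G]`.  Proof: `φ(A·F) = φ(A)·φF` (`map_linSubst`),
adjointness twice, multiplicativity of `linSubst`. [cite: BeauzamyBombieriEnfloMontgomery1990, §1] -/
theorem fischer_map_linSubst_of_gram [DecidableEq ι] (φ : k →+* k) (D A : Matrix ι ι k)
    (hA : Aᵀ * Dᵀ * A.map φ = Dᵀ) (F G : MvPolynomial ι k) :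
    coeff 0 (apolarAction (map φ (linSubst ι k A F)) (linSubst ι k D (linSubst ι k A G))) =
      coeff 0 (apolarAction (map φ F) (linSubst ι k D G)) := by
  rw [map_linSubst, ← AlgHom.comp_apply, ← linSubst_mul, coeff_zero_apolarAction_linSubst,
    ← AlgHom.comp_apply, ← linSubst_mul, Matrix.transpose_mul, Matrix.mul_assoc, ← Matrix.mul_assoc, hA,
    ← coeff_zero_apolarAction_linSubst]

/-- Coefficients under a diagonal substitution: `coeff μ (diag(c) · F) = c^μ · coeff μ F`. [folklore] -/
theorem coeff_linSubst_diagonal [DecidableEq ι] (c : ι → k) (F : MvPolynomial ι k) (μ : ι →₀ ℕ) :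
    coeff μ (linSubst ι k (Matrix.diagonal c) F) = (∏ i ∈ μ.support, c i ^ μ i) * coeff μ F := by
  induction F using MvPolynomial.induction_on' with
  | monomial ν a =>
    rw [linSubst_diagonal_monomial, coeff_smul, coeff_monomial, smul_eq_mul, Finsupp.prod]
    split_ifs with h
    · subst h; rfl
    · rw [mul_zero, mul_zero]
  | add p q hp hq => rw [map_add, coeff_add, coeff_add, hp, hq, mul_add]

/-- **The weighted sesquilinear Fischer form as an explicit sum**: for a diagonal weight matrix and an INJECTIVE
coefficient endomorphism `φ`, `[φ F, diag(c) · G] = Σ_{μ ∈ supp F} μ! c^μ φ(F_μ) G_μ` — the monomials are orthogonal,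
with weights `μ! c^μ`. [cite: BeauzamyBombieriEnfloMontgomery1990, §1] -/
theorem coeff_zero_apolarAction_map_diagonal [DecidableEq ι] (φ : k →+* k) (hφ : Function.Injective φ)
    (c : ι → k) (F G : MvPolynomial ι k) :
    coeff 0 (apolarAction (map φ F) (linSubst ι k (Matrix.diagonal c) G)) =
      ∑ μ ∈ F.support, (∏ i ∈ μ.support, ((μ i).factorial : k)) * (∏ i ∈ μ.support, c i ^ μ i) *
        φ (coeff μ F) * coeff μ G := by
  rw [coeff_zero_apolarAction, support_map_of_injective _ hφ]
  refine Finset.sum_congr rfl fun μ _ => ?_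
  rw [coeff_map, coeff_linSubst_diagonal]
  ring

end Pairing

section Complex

variable {ι : Type*} [Fintype ι] [DecidableEq ι]

/-- **Unitary invariance of the Bombieri inner product** `⟨F, G⟩ = Σ_d d! conj(F_d) G_d = [conj F, G]`:
for a unitary matrix `U` (`U⋆ U = 1`), `⟨U·F, U·G⟩ = ⟨F, G⟩`.
[cite: BeauzamyBombieriEnfloMontgomery1990, §1] -/
theorem bombieri_linSubst_of_unitary (U : Matrix ι ι ℂ) (hU : star U * U = 1) (F G : MvPolynomial ι ℂ) :
    coeff 0 (apolarAction (map (starRingEnd ℂ) (linSubst ι ℂ U F)) (linSubst ι ℂ U G)) =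
      coeff 0 (apolarAction (map (starRingEnd ℂ) F) G) := by
  have hgram : Uᵀ * (1 : Matrix ι ι ℂ)ᵀ * U.map (starRingEnd ℂ) = (1 : Matrix ι ι ℂ)ᵀ := by
    rw [Matrix.transpose_one, Matrix.mul_one]
    have h := congrArg Matrix.transpose hU
    rw [Matrix.transpose_mul, Matrix.transpose_one, Matrix.star_eq_conjTranspose,
      Matrix.conjTranspose, Matrix.transpose_map, Matrix.transpose_transpose] at h
    -- `h : Uᵀ * (U.map star) = 1`, and `star = conj` on `ℂ`
    rw [show (⇑(starRingEnd ℂ) : ℂ → ℂ) = Star.star from funext (starRingEnd_apply (R := ℂ))]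
    exact h
  have h := fischer_map_linSubst_of_gram (starRingEnd ℂ) 1 U hgram F G
  rwa [linSubst_one] at h

/-- **Definiteness**: if `G₁, G₂` are obtained from one polynomial `F ≠ 0` by rescaling its coefficients with
POSITIVE reals (`(Gₗ)_μ = tₗ(μ) F_μ`) and the diagonal weights `c` are positive reals, then
`[conj G₁, diag(c) · G₂] = Σ_μ μ! c^μ t₁(μ) t₂(μ) |F_μ|²` is a nonzero (indeed positive) number.  (The case
`t₁ = t₂ = 1`: the weighted Bombieri form is positive definite; the general case is what makes a positive
diagonal rescaling "positive self-adjoint".) [cite: BeauzamyBombieriEnfloMontgomery1990, §1] -/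
theorem fischer_diagonal_scaled_ne_zero (c : ι → ℝ) (hc : ∀ i, 0 < c i) (t₁ t₂ : (ι →₀ ℕ) → ℝ)
    (ht₁ : ∀ μ, 0 < t₁ μ) (ht₂ : ∀ μ, 0 < t₂ μ) (F G₁ G₂ : MvPolynomial ι ℂ)
    (h₁ : ∀ μ, coeff μ G₁ = (t₁ μ : ℂ) * coeff μ F) (h₂ : ∀ μ, coeff μ G₂ = (t₂ μ : ℂ) * coeff μ F)
    (hF : F ≠ 0) :
    coeff 0 (apolarAction (map (starRingEnd ℂ) G₁)
      (linSubst ι ℂ (Matrix.diagonal fun i => ((c i : ℝ) : ℂ)) G₂)) ≠ 0 := by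
  rw [coeff_zero_apolarAction_map_diagonal _ (RingHom.injective _)]
  have hsupp : G₁.support = F.support := by
    ext μ
    simp only [mem_support_iff, h₁ μ, ne_eq, mul_eq_zero, Complex.ofReal_eq_zero, (ht₁ μ).ne', false_or]
  rw [hsupp]
  have hterm : ∀ μ, (∏ i ∈ μ.support, ((μ i).factorial : ℂ)) * (∏ i ∈ μ.support, ((c i : ℝ) : ℂ) ^ μ i) *
      (starRingEnd ℂ) (coeff μ G₁) * coeff μ G₂ =
        (((∏ i ∈ μ.support, ((μ i).factorial : ℝ)) * (∏ i ∈ μ.support, c i ^ μ i) * (t₁ μ * t₂ μ) *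
          ‖coeff μ F‖ ^ 2 : ℝ) : ℂ) := by
    intro μ
    rw [h₁, h₂, map_mul, Complex.conj_ofReal]
    push_cast
    rw [← Complex.ofReal_pow, ← Complex.normSq_eq_norm_sq, Complex.normSq_eq_conj_mul_self]
    ring
  simp only [hterm]
  rw [← Complex.ofReal_sum, Complex.ofReal_ne_zero]
  apply ne_of_gt
  apply Finset.sum_pos
  · intro μ hμ
    have hFμ : 0 < ‖coeff μ F‖ := norm_pos_iff.mpr (mem_support_iff.mp hμ)
    have hfac : 0 < ∏ i ∈ μ.support, ((μ i).factorial : ℝ) :=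
      Finset.prod_pos fun i _ => by exact_mod_cast Nat.factorial_pos _
    have hcμ : 0 < ∏ i ∈ μ.support, c i ^ μ i := Finset.prod_pos fun i _ => pow_pos (hc i) _
    exact mul_pos (mul_pos (mul_pos hfac hcμ) (mul_pos (ht₁ μ) (ht₂ μ))) (pow_pos hFμ 2)
  · rw [Finset.nonempty_iff_ne_empty, ne_eq, support_eq_empty]
    exact hF

end Complex

end Literature.Computability.AlgebraicComplexity
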